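import Mathlib
import Summits.AtomisticToContinuum.Crystallization.Theorems.NashClassCertificatesNashNearFieldStubTriLandscapeTermwise

/-!
# Crux `NashNearField` (16827), stub `stub_triLandscapeNearOblique` (NEAR′): the cubic Taylor polynomial of
# `q ↦ V_LJ(√q)` is an exact LOWER model on `q³ ≤ 4` (first-shell bonds)

For the retained first-shell terms of the NEAR′ certificate the only non-polynomial ingredient is the scalar function
`G(q) = V_LJ(√q) = q⁻⁶/12 − q⁻³/6` of the squared distance (`tri_lj_sqrt_eq`).  Its fourth derivative
`G'''' = 252 q⁻¹⁰ − 60 q⁻⁷` is positive for `q³ < 21/5`, so on that range the cubic Taylor polynomial at any `q₀` is a lower bound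
at every `q` (both signs of `q − q₀`).  We prove the algebraic form with the margin `q³, q₀³ ≤ 4` (`q ≤ 1.587`; first-shell squared
distances stay in `[0.6, 1.3]` on the whole near region):
* `tri_lj_quartic_identity` — the EXACT remainder
  `G(q) − T₃(q; q₀) = (q − q₀)⁴ · N(q, q₀) / (12 q⁶ q₀⁹)`,
  `N = q₀⁵ + 4q₀⁴q + 10q₀³q² + 20q₀²q³ + 35q₀q⁴ + 56q⁵ − 2q³q₀³(q₀² + 4q₀q + 10q²)`
  (the binomial remainders `r⁶ρ₆ = (r−1)⁴(1 + 4r + 10r² + 20r³ + 35r⁴ + 56r⁵)`, `r⁶ρ₃ = (r−1)⁴r³(1 + 4r + 10r²)`, `r = q/q₀`);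
* `tri_lj_quartic_num_nonneg` — `N ≥ 0` when `q³ ≤ 4`, `q₀³ ≤ 4` (case `q ≤ q₀`: `N ≥ q₀⁵P_B(q/q₀)`, `P_B ≥ 1 + 4r + r²`;
  case `q₀ ≤ q`: `N ≥ q₀⁵(13r − 7) ≥ 6q₀⁵`);
* `tri_lj_cubic_lower` — **the cubic lower model**: `G(q₀) + G′(q₀)d + G″(q₀)d²/2 + G‴(q₀)d³/6 ≤ V_LJ(√q)`, `d = q − q₀`, with
  `G′ = −q₀⁻⁷/2 + q₀⁻⁴/2`, `G″ = (7/2)q₀⁻⁸ − 2q₀⁻⁵`, `G‴ = −28q₀⁻⁹ + 10q₀⁻⁶`.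
So a first-shell layer term exceeds `[linear + quadratic + cubic]` forms in the strain EXACTLY — no interval remainder is needed
there; with `tri_q_expand` (`q_T` exactly quadratic in the strain) each retained term is bounded below by an explicit degree-6
polynomial in the six strain components.
-/

noncomputable section

open Literature.MathematicalPhysics.StatisticalMechanics

namespace Summit.AtomisticToContinuum.Crystallization.Theorems.NashClassCertificatesNashNearField

/-- **Exact quartic remainder of the cubic Taylor polynomial of `G(q) = q⁻⁶/12 − q⁻³/6`.** [folklore] -/
theorem tri_lj_quartic_identity {q q₀ : ℝ} (hq : 0 < q) (hq₀ : 0 < q₀) :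
    ((1 / 12) * q⁻¹ ^ 6 - (1 / 6) * q⁻¹ ^ 3) -
        (((1 / 12) * q₀⁻¹ ^ 6 - (1 / 6) * q₀⁻¹ ^ 3) + (-(q₀⁻¹ ^ 7) / 2 + q₀⁻¹ ^ 4 / 2) * (q - q₀) +
          ((7 / 2) * q₀⁻¹ ^ 8 - 2 * q₀⁻¹ ^ 5) * (q - q₀) ^ 2 / 2 + (-28 * q₀⁻¹ ^ 9 + 10 * q₀⁻¹ ^ 6) * (q - q₀) ^ 3 / 6) =
      (q - q₀) ^ 4 * (q₀ ^ 5 + 4 * q₀ ^ 4 * q + 10 * q₀ ^ 3 * q ^ 2 + 20 * q₀ ^ 2 * q ^ 3 + 35 * q₀ * q ^ 4 + 56 * q ^ 5 -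
        2 * q ^ 3 * q₀ ^ 3 * (q₀ ^ 2 + 4 * q₀ * q + 10 * q ^ 2)) / (12 * q ^ 6 * q₀ ^ 9) := by
  have hq' : q ≠ 0 := hq.ne'
  have hq₀' : q₀ ≠ 0 := hq₀.ne'
  field_simp
  ring

/-- **The remainder numerator is non-negative on `q³, q₀³ ≤ 4`.** [folklore] -/
theorem tri_lj_quartic_num_nonneg {q q₀ : ℝ} (hq : 0 < q) (hq₀ : 0 < q₀) (hq4 : q ^ 3 ≤ 4) (hq₀4 : q₀ ^ 3 ≤ 4) :
    0 ≤ q₀ ^ 5 + 4 * q₀ ^ 4 * q + 10 * q₀ ^ 3 * q ^ 2 + 20 * q₀ ^ 2 * q ^ 3 + 35 * q₀ * q ^ 4 + 56 * q ^ 5 -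
        2 * q ^ 3 * q₀ ^ 3 * (q₀ ^ 2 + 4 * q₀ * q + 10 * q ^ 2) := by
  have hb : 0 ≤ q₀ ^ 2 + 4 * q₀ * q + 10 * q ^ 2 := by positivity
  rcases le_total q q₀ with hle | hle
  · -- `q ≤ q₀`: replace `q₀³` by `4` in the subtracted term, then `N ≥ q₀⁵ P_B(q/q₀)` with `P_B ≥ 1 + 4r + r² > 0`
    have h1 : 2 * q ^ 3 * q₀ ^ 3 * (q₀ ^ 2 + 4 * q₀ * q + 10 * q ^ 2) ≤ 8 * q ^ 3 * (q₀ ^ 2 + 4 * q₀ * q + 10 * q ^ 2) := by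
      have : 2 * q ^ 3 * q₀ ^ 3 ≤ 8 * q ^ 3 := by nlinarith [pow_pos hq 3]
      exact mul_le_mul_of_nonneg_right this hb
    have hd : 0 ≤ q₀ - q := sub_nonneg.2 hle
    have e1 : 0 ≤ q ^ 4 * (q₀ - q) := mul_nonneg (by positivity) hd
    have e2 : 0 ≤ q ^ 3 * q₀ * (q₀ - q) := mul_nonneg (by positivity) hd
    have e3 : 0 ≤ q ^ 2 * q₀ ^ 2 * (q₀ - q) := mul_nonneg (by positivity) hd
    nlinarith [e1, e2, e3, pow_pos hq₀ 5, mul_pos (pow_pos hq₀ 4) hq, mul_pos (pow_pos hq₀ 3) (pow_pos hq 2)]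
  · -- `q₀ ≤ q`: replace `q³` by `4`, then `N ≥ q₀⁵(13 r − 7) ≥ 6 q₀⁵`
    have h1 : 2 * q ^ 3 * q₀ ^ 3 * (q₀ ^ 2 + 4 * q₀ * q + 10 * q ^ 2) ≤ 8 * q₀ ^ 3 * (q₀ ^ 2 + 4 * q₀ * q + 10 * q ^ 2) := by
      have : 2 * q ^ 3 * q₀ ^ 3 ≤ 8 * q₀ ^ 3 := by nlinarith [pow_pos hq₀ 3]
      exact mul_le_mul_of_nonneg_right this hb
    have hd : 0 ≤ q - q₀ := sub_nonneg.2 hle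
    have e1 : 0 ≤ q ^ 2 * (q ^ 2 + q * q₀ + q₀ ^ 2) * (q - q₀) := mul_nonneg (by positivity) hd
    have e2 : 0 ≤ q₀ * q ^ 2 * (q + q₀) * (q - q₀) := mul_nonneg (by positivity) hd
    have e3 : 0 ≤ q₀ ^ 2 * q ^ 2 * (q - q₀) := mul_nonneg (by positivity) hd
    have e4 : 0 ≤ q₀ ^ 3 * q * (q - q₀) := mul_nonneg (by positivity) hd
    have e5 : 0 ≤ q₀ ^ 4 * (q - q₀) := mul_nonneg (by positivity) hd
    nlinarith [e1, e2, e3, e4, e5, pow_pos hq₀ 5]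

/-- **The cubic Taylor polynomial of `q ↦ V_LJ(√q)` is a lower bound on `q³, q₀³ ≤ 4`** (both signs of `q − q₀`):
`G(q₀) + G′(q₀)(q−q₀) + G″(q₀)(q−q₀)²/2 + G‴(q₀)(q−q₀)³/6 ≤ V_LJ(√q)`. [folklore] -/
theorem tri_lj_cubic_lower {q q₀ : ℝ} (hq : 0 < q) (hq₀ : 0 < q₀) (hq4 : q ^ 3 ≤ 4) (hq₀4 : q₀ ^ 3 ≤ 4) :
    lennardJones (Real.sqrt q₀) + (-(q₀⁻¹ ^ 7) / 2 + q₀⁻¹ ^ 4 / 2) * (q - q₀) +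
        ((7 / 2) * q₀⁻¹ ^ 8 - 2 * q₀⁻¹ ^ 5) * (q - q₀) ^ 2 / 2 + (-28 * q₀⁻¹ ^ 9 + 10 * q₀⁻¹ ^ 6) * (q - q₀) ^ 3 / 6 ≤
      lennardJones (Real.sqrt q) := by
  rw [tri_lj_sqrt_eq hq, tri_lj_sqrt_eq hq₀, ← sub_nonneg, tri_lj_quartic_identity hq hq₀]
  apply div_nonneg (mul_nonneg (by positivity) (tri_lj_quartic_num_nonneg hq hq₀ hq4 hq₀4))
  positivity

/-- The cubic lower model in `Bregman` form: the excess of `V_LJ(√q)` over its tangent at `q₀` is at least the quadratic-plus-cubic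
form `G″(q₀)d²/2 + G‴(q₀)d³/6` (`d = q − q₀`), on `q³, q₀³ ≤ 4`. [folklore] -/
theorem tri_lj_bregman_ge_cubic {q q₀ : ℝ} (hq : 0 < q) (hq₀ : 0 < q₀) (hq4 : q ^ 3 ≤ 4) (hq₀4 : q₀ ^ 3 ≤ 4) :
    ((7 / 2) * q₀⁻¹ ^ 8 - 2 * q₀⁻¹ ^ 5) * (q - q₀) ^ 2 / 2 + (-28 * q₀⁻¹ ^ 9 + 10 * q₀⁻¹ ^ 6) * (q - q₀) ^ 3 / 6 ≤
      lennardJones (Real.sqrt q) - lennardJones (Real.sqrt q₀) - (-(q₀⁻¹ ^ 7) / 2 + q₀⁻¹ ^ 4 / 2) * (q - q₀) := by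
  have := tri_lj_cubic_lower hq hq₀ hq4 hq₀4
  linarith

end Summit.AtomisticToContinuum.Crystallization.Theorems.NashClassCertificatesNashNearField

end
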